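import Summits.HodgeConjecture.CorCM.RelativePairFlipShadows
import HarnessLib

/-!
# RELATIVE PAIR FLIPS, III: POINTWISE partial conjugations off the fibres suffice — the exact criterion for a pair-flip
# base inside the partner slot under a per-point hypothesis

COR-CM (cell `pub-hodgecm2`, binder seat `b16` gen 52, count-neutral claim TOWER-SHADOW, file F6 — abstract `G`-set
level; theorems only, no definition, no named fact, no `sorry`).  NEW as stated, hence under `Summits/`.  HONEST FRAMING:
finite-dimensional linear algebra about the Kubota–Dodson rank of families of CM types; `HC_CM` is neither used nor
asserted.

F1/F2 (`RelativePairFlipKernel`, `RelativePairFlipShadows`) assumed a RELATIVE PAIR FLIP at `x₀`: ONE `σ ∈ G` with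
`σ x₀ = ρ x₀` fixing EVERY point of the partner slot off the two fibres `r⁻¹x₀`, `r⁻¹(ρx₀)`.  The kernel computation only
ever uses, for each off-fibre point `y`, SOME `σ_y` with `σ_y x₀ = ρ x₀`, `σ_y y = y` — a POINTWISE PARTIAL CONJUGATION in
the sense of seat b16 gen 48 (`PointwiseConjugationCompositum`: for CM fields `∃ σ, σ ∘ x₀ = x̄₀ ∧ σ ∘ y = y` iff
`y(K₁) ⊄ x₀(K₀) · y(K₁⁺)`, a compositum test per pair).  This file re-runs the argument under that weaker hypothesis
(pair flips of the base slot, needed for the irreducibility of `U(Φ_{i₀})`, are now a separate hypothesis):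

* §1 **`antiVec_one_eq_mul_fibreSum_of_collapse_of_pointwise`** — the kernel computation: an equivariant `L : ℚ^Y → ℚ^X`
  with `L u_1(Φ₁) = u_1(Φ₀)` forces the shadow of `Φ₁` on `X` to be a non-zero multiple of `u_1(Φ₀)`.
* §2 **`forall_map_le_iff_not_parallel_of_pointwise`**, **`typeRank_sigmaType_add_card_eq_iff_not_exists_multiplicities_of_pointwise`**,
  **`typeRank_sigmaType_eq_iff_not_exists_multiplicities_of_pointwise`** — `I = {i₀, i₁}`, `U(Φ_{i₀})` irreducible (resp.
  a pair-flip base), `G` transitive on both slots, pointwise partial conjugations off the fibres of one `x₀`: the pair is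
  ADDITIVE (`Hg(A₀ × A₁) = Hg(A₀) × Hg(A₁)`) IFF `Φ_{i₁}` does not lie over `Φ_{i₀}` with constant unequal multiplicities;
  nondegenerate IFF moreover `Φ_{i₁}` is.  `pointwise_of_relFlip`: F2's hypothesis implies this one.
Number fields: sequel `GenericCMSubfieldTowerPointwise`.

## References

* [Gordon1999HodgeAVSurvey] B. B. Gordon, *A survey of the Hodge conjecture for abelian varieties*, §3 Theorem (Imai,
  Murty) with proof, 7.5–7.7, 9.4.3.
* [Serre1977] J.-P. Serre, *Linear Representations of Finite Groups*, GTM 42, §2.2, §7.2.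
* [Lang2002] S. Lang, *Algebra*, GTM 211, V §2 Thm. 2.8, VI §1 Thm. 1.12 (extension of automorphisms; the compositum test).
* [Dodson1984] B. Dodson, *The structure of Galois groups of CM-fields*, Trans. AMS 283 (1984), §1.1, §5.1.2.
-/

set_option autoImplicit false

noncomputable section

open scoped BigOperators

universe u v

namespace Summit.HodgeConjecture.CorCM.Shadow

open Literature.NumberTheory.ComplexMultiplication
open scoped Classical

variable {G : Type u} [Group G]

/-! ### §1 The kernel computation under pointwise partial conjugations -/

section Kernel

variable {X Y : Type*} [MulAction G X] [MulAction G Y] [Fintype X] [Fintype Y]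

omit [Fintype X] [Fintype Y] in
/-- A relative pair flip supplies pointwise partial conjugations (the same `σ` for every `y`). [folklore] -/
theorem pointwise_of_relFlip {ρ : G} (r : Y → X) {x₀ : X}
    (hflip : ∃ σ : G, σ • x₀ = ρ • x₀ ∧ ∀ y : Y, r y ≠ x₀ → r y ≠ ρ • x₀ → σ • y = y) :
    ∀ y : Y, r y ≠ x₀ → r y ≠ ρ • x₀ → ∃ σ : G, σ • x₀ = ρ • x₀ ∧ σ • y = y := by
  obtain ⟨σ, hσx, hσ⟩ := hflip
  exact fun y h1 h2 => ⟨σ, hσx, hσ y h1 h2⟩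

omit [Fintype X] in
/-- **The kernel computation under POINTWISE partial conjugations.**  `G` transitive on `X` and on `Y`, `r : Y → X`
equivariant, `Φ₀ ⊆ X` and `Φ₁ ⊆ Y` CM types for `ρ`, and for every `y` OFF the fibres of `x₀`, `ρ x₀` SOME `σ_y ∈ G`
(depending on `y`) with `σ_y x₀ = ρ x₀` and `σ_y y = y`.  Then every `G`-equivariant `L : ℚ^Y → ℚ^X` with
`L u_1(Φ₁) = u_1(Φ₀)` makes the shadow of `Φ₁` PARALLEL to `u_1(Φ₀)`: `u_1(Φ₀)(x) = c · Σ_{r y = x} u_1(Φ₁)(y)`, `c ≠ 0`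
(same functional `ℓ(y) = (Lδ_y)(x₀) − (Lδ_y)(ρx₀)` as in `RelativePairFlipKernel`; its vanishing off the fibres only ever
used one `σ` per point `y`). [cite: Serre1977, §7.2] [cite: Gordon1999HodgeAVSurvey, §3 Theorem (proof)] -/
theorem antiVec_one_eq_mul_fibreSum_of_collapse_of_pointwise [MulAction.IsPretransitive G X]
    [MulAction.IsPretransitive G Y] [Nonempty Y] {ρ : G} {Φ₀ : Set X} {Φ₁ : Set Y} (h₀ : IsCMTypeWith ρ Φ₀)
    (h₁ : IsCMTypeWith ρ Φ₁) (r : Y → X) (hr : ∀ (g : G) (y : Y), r (g • y) = g • r y) {x₀ : X}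
    (hpc : ∀ y : Y, r y ≠ x₀ → r y ≠ ρ • x₀ → ∃ σ : G, σ • x₀ = ρ • x₀ ∧ σ • y = y)
    (L : (Y → ℚ) →ₗ[ℚ] (X → ℚ)) (hL : ∀ (g : G) (f : Y → ℚ), L (fun y => f (g • y)) = fun x => L f (g • x))
    (hLu : L (antiVec Φ₁ (1 : G)) = antiVec Φ₀ (1 : G)) :
    ∃ c : ℚ, c ≠ 0 ∧ ∀ x : X, antiVec Φ₀ (1 : G) x =
      c * ∑ y ∈ Finset.univ.filter (fun y : Y => r y = x), antiVec Φ₁ (1 : G) y := by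
  -- the invariant kernel `S y x = (L δ_y)(x)`
  set S : Y → X → ℚ := fun y x => L (Pi.single y 1) x with hSdef
  have hSinv : ∀ (g : G) (y : Y) (x : X), S (g • y) (g • x) = S y x := by
    intro g y x
    have h1 : (fun y' => (Pi.single (g • y) (1 : ℚ) : Y → ℚ) (g • y')) = Pi.single y 1 := by
      funext y'
      by_cases hy : y' = y
      · rw [hy, Pi.single_eq_same, Pi.single_eq_same]
      · rw [Pi.single_eq_of_ne hy, Pi.single_eq_of_ne (fun h => hy (smul_left_cancel g h))]
    have h2 := hL g (Pi.single (g • y) 1)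
    rw [h1] at h2
    exact (congrFun h2 x).symm
  -- expansion of `(L f)(x)` along the kernel
  have hexp : ∀ (f : Y → ℚ) (x : X), L f x = ∑ y, f y * S y x := by
    intro f x
    have hf : f = ∑ y, f y • (Pi.single y (1 : ℚ) : Y → ℚ) := by
      funext y'
      rw [Finset.sum_apply]
      simp only [Pi.smul_apply, Pi.single_apply, smul_eq_mul, mul_ite, mul_one, mul_zero]
      rw [Finset.sum_ite_eq Finset.univ y' f, if_pos (Finset.mem_univ _)]
    conv_lhs => rw [hf]
    rw [map_sum, Finset.sum_apply]
    refine Finset.sum_congr rfl fun y _ => ?_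
    rw [map_smul, Pi.smul_apply, smul_eq_mul]
  -- the functional `ℓ(y) = S y x₀ − S y (ρ x₀)`: constant on `r⁻¹ x₀`, zero off the two fibres, odd under `ρ`
  have hfib : ∀ y y' : Y, r y = x₀ → r y' = x₀ →
      S y x₀ - S y (ρ • x₀) = S y' x₀ - S y' (ρ • x₀) := by
    intro y y' hy hy'
    obtain ⟨g, hg⟩ := MulAction.exists_smul_eq G y y'
    have hgx : g • x₀ = x₀ := by rw [← hy, ← hr, hg, hy', hy]
    rw [← hSinv g y x₀, ← hSinv g y (ρ • x₀), hg, h₀.comm g x₀, hgx]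
  have hoff : ∀ y : Y, r y ≠ x₀ → r y ≠ ρ • x₀ → S y x₀ - S y (ρ • x₀) = 0 := by
    intro y hy hy'
    obtain ⟨σ, hσx, hσy⟩ := hpc y hy hy'
    have h1 : S y x₀ = S y (ρ • x₀) := by rw [← hSinv σ y x₀, hσy, hσx]
    rw [h1, sub_self]
  have hopp : ∀ y : Y, S y x₀ - S y (ρ • x₀) = -(S (ρ • y) x₀ - S (ρ • y) (ρ • x₀)) := by
    intro y
    rw [← hSinv ρ y x₀, ← hSinv ρ y (ρ • x₀), h₀.invol]
    ring
  -- a base point of `r⁻¹ x₀` and the constant `c`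
  obtain ⟨y₁⟩ := ‹Nonempty Y›
  obtain ⟨g₁, hg₁⟩ := MulAction.exists_smul_eq G (r y₁) x₀
  have hy₀ : r (g₁ • y₁) = x₀ := by rw [hr, hg₁]
  set c : ℚ := S (g₁ • y₁) x₀ - S (g₁ • y₁) (ρ • x₀) with hcdef
  have hx₀ρ : ρ • x₀ ≠ x₀ := h₀.rho_smul_ne x₀
  have hℓval : ∀ y : Y, S y x₀ - S y (ρ • x₀) =
      c * ((if r y = x₀ then (1 : ℚ) else 0) - if r y = ρ • x₀ then (1 : ℚ) else 0) := by
    intro y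
    by_cases hy1 : r y = x₀
    · rw [if_pos hy1, if_neg (by rw [hy1]; exact hx₀ρ.symm), sub_zero, mul_one]
      exact hfib y _ hy1 hy₀
    · by_cases hy2 : r y = ρ • x₀
      · rw [if_neg hy1, if_pos hy2, zero_sub, mul_neg, mul_one, hopp y]
        have h3 : r (ρ • y) = x₀ := by rw [hr, hy2, h₀.invol]
        rw [hfib (ρ • y) _ h3 hy₀]
      · rw [if_neg hy1, if_neg hy2, sub_zero, mul_zero]
        exact hoff y hy1 hy2
  -- pair `ℓ` with the translates of `u_1(Φ₁)`
  have hodd₀ : ∀ x : X, antiVec Φ₀ (1 : G) (ρ • x) = -antiVec Φ₀ (1 : G) x := fun x =>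
    (mem_antiWeights_iff'.1 (antiVec_mem_antiWeights h₀ 1)) x
  have key : ∀ g : G, 2 * antiVec Φ₀ (1 : G) (g • x₀) =
      2 * (c * ∑ y ∈ Finset.univ.filter (fun y : Y => r y = g • x₀), antiVec Φ₁ (1 : G) y) := by
    intro g
    have hLg : L (fun y => antiVec Φ₁ (1 : G) (g • y)) = fun x => antiVec Φ₀ (1 : G) (g • x) := by
      rw [hL g, hLu]
    -- left-hand side
    have lhs : L (fun y => antiVec Φ₁ (1 : G) (g • y)) x₀ - L (fun y => antiVec Φ₁ (1 : G) (g • y)) (ρ • x₀) =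
        2 * antiVec Φ₀ (1 : G) (g • x₀) := by
      rw [hLg]
      show antiVec Φ₀ (1 : G) (g • x₀) - antiVec Φ₀ (1 : G) (g • ρ • x₀) = _
      rw [h₀.comm g x₀, hodd₀]
      ring
    -- right-hand side through the kernel
    have rhs : L (fun y => antiVec Φ₁ (1 : G) (g • y)) x₀ - L (fun y => antiVec Φ₁ (1 : G) (g • y)) (ρ • x₀) =
        c * ((∑ y, (if r y = x₀ then (1 : ℚ) else 0) * antiVec Φ₁ (1 : G) (g • y)) -
          ∑ y, (if r y = ρ • x₀ then (1 : ℚ) else 0) * antiVec Φ₁ (1 : G) (g • y)) := by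
      rw [hexp _ x₀, hexp _ (ρ • x₀), ← Finset.sum_sub_distrib, mul_sub, Finset.mul_sum, Finset.mul_sum,
        ← Finset.sum_sub_distrib]
      refine Finset.sum_congr rfl fun y _ => ?_
      rw [← mul_sub, hℓval y]
      ring
    rw [sum_fibreInd_mul_eq, sum_fibreInd_mul_eq, fibreSum_comp_smul r hr _ g x₀,
      fibreSum_comp_smul r hr _ g (ρ • x₀), h₀.comm g x₀, fibreSum_antiVec_one_rho_smul h₁ hr (g • x₀)] at rhs
    rw [← lhs, rhs]
    ring
  -- conclusion
  have hc0 : c ≠ 0 := by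
    intro h0
    have h := key 1
    rw [h0, zero_mul, mul_zero, one_smul] at h
    exact antiVec_ne_zero Φ₀ (1 : G) x₀ (by linarith)
  refine ⟨c, hc0, fun x => ?_⟩
  obtain ⟨g, rfl⟩ := MulAction.exists_smul_eq G x₀ x
  have h := key g
  linarith


end Kernel

/-! ### §2 Families: the exact criterion under pointwise partial conjugations -/

section Family

variable {I : Type v} {E : I → Type v} [∀ i, MulAction G (E i)] [DecidableEq I] [Fintype I] [∀ i, Fintype (E i)]
  {ρ : G} {Φ : ∀ i, Set (E i)} {i₀ i₁ : I} [Nonempty I] [∀ i, Nonempty (E i)]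

/-- **Additive IFF the shadows are not parallel**, under pointwise partial conjugations off the fibres of `x₀`
(`U(Φ_{i₀})` irreducible, `I = {i₀, i₁}`, `G` transitive on both slots).
[cite: Gordon1999HodgeAVSurvey, §3 Theorem and 7.5–7.7, 9.4.3] [cite: Serre1977, §2.2 and §7.2] -/
theorem forall_map_le_iff_not_parallel_of_pointwise [MulAction.IsPretransitive G (E i₀)]
    [MulAction.IsPretransitive G (E i₁)] (h : ∀ i, IsCMTypeWith ρ (Φ i)) (hI : ∀ j, j = i₀ ∨ j = i₁) (h01 : i₀ ≠ i₁)
    (hirr : ∀ W : Submodule ℚ (E i₀ → ℚ), W ≤ antiSpan G (Φ i₀) → W ≠ ⊥ →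
      (∀ (k : G) (f : E i₀ → ℚ), f ∈ W → (fun y => f (k • y)) ∈ W) → W = antiSpan G (Φ i₀))
    (r : E i₁ → E i₀) (hr : ∀ (g : G) (y : E i₁), r (g • y) = g • r y) {x₀ : E i₀}
    (hpc : ∀ y : E i₁, r y ≠ x₀ → r y ≠ ρ • x₀ → ∃ σ : G, σ • x₀ = ρ • x₀ ∧ σ • y = y) :
    (∀ i, (antiSpan G (Φ i)).map (slotExt i) ≤ antiSpan G (sigmaType Φ)) ↔
      ¬ ∃ c : ℚ, ∀ x : E i₀, antiVec (Φ i₀) (1 : G) x =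
        c * ∑ y ∈ Finset.univ.filter (fun y : E i₁ => r y = x), antiVec (Φ i₁) (1 : G) y := by
  constructor
  · rintro hadd ⟨c, hc⟩
    have h1 := typeRank_sigmaType_add_card_eq_of_forall_map_le h hadd
    have h2 := typeRank_sigmaType_add_card_lt_of_parallel_self h h01 r hr hc
    omega
  · intro hnot
    rcases PairFlipTransport.additive_or_exists_collapse_of_irreducible hI h01 hirr with hadd | ⟨L, hL, -, hLu⟩
    · exact hadd
    · obtain ⟨c, -, hc⟩ := antiVec_one_eq_mul_fibreSum_of_collapse_of_pointwise (h i₀) (h i₁) r hr hpc L hL hLu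
      exact absurd ⟨c, hc⟩ hnot

/-- **THE EXACT CRITERION (rank form) under pointwise partial conjugations**: `rank(Σ) + 2 = rank Φ_{i₀} + rank Φ_{i₁} + 1`
IFF `Φ_{i₁}` does NOT lie over `Φ_{i₀}` with constant multiplicities `(a, b)`, `a ≠ b`.
[cite: Gordon1999HodgeAVSurvey, §3 Theorem (1), 7.5–7.7 and 9.4.3] -/
theorem typeRank_sigmaType_add_card_eq_iff_not_exists_multiplicities_of_pointwise [MulAction.IsPretransitive G (E i₀)]
    [MulAction.IsPretransitive G (E i₁)] (h : ∀ i, IsCMTypeWith ρ (Φ i)) (hI : ∀ j, j = i₀ ∨ j = i₁) (h01 : i₀ ≠ i₁)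
    (hirr : ∀ W : Submodule ℚ (E i₀ → ℚ), W ≤ antiSpan G (Φ i₀) → W ≠ ⊥ →
      (∀ (k : G) (f : E i₀ → ℚ), f ∈ W → (fun y => f (k • y)) ∈ W) → W = antiSpan G (Φ i₀))
    (r : E i₁ → E i₀) (hr : ∀ (g : G) (y : E i₁), r (g • y) = g • r y) {x₀ : E i₀}
    (hpc : ∀ y : E i₁, r y ≠ x₀ → r y ≠ ρ • x₀ → ∃ σ : G, σ • x₀ = ρ • x₀ ∧ σ • y = y) :
    typeRank G (sigmaType Φ) + Fintype.card I = (∑ i, typeRank G (Φ i)) + 1 ↔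
      ¬ ∃ a b : ℕ, a ≠ b ∧ ∀ x : E i₀,
        (Finset.univ.filter fun y : E i₁ => r y = x ∧ y ∈ Φ i₁).card = if x ∈ Φ i₀ then a else b := by
  rw [← parallel_iff_exists_multiplicities (h i₀) (h i₁) r hr]
  constructor
  · rintro heq ⟨c, hc⟩
    have h2 := typeRank_sigmaType_add_card_lt_of_parallel_self h h01 r hr hc
    omega
  · intro hnot
    exact typeRank_sigmaType_add_card_eq_of_forall_map_le h
      ((forall_map_le_iff_not_parallel_of_pointwise h hI h01 hirr r hr hpc).2 hnot)

/-- **THE EXACT CRITERION (nondegeneracy form) under pointwise partial conjugations**: with `Φ_{i₀}` nondegenerate, `Σ` is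
nondegenerate IFF `Φ_{i₁}` is nondegenerate AND does not lie over `Φ_{i₀}` with constant unequal multiplicities.
[cite: Gordon1999HodgeAVSurvey, 7.5–7.7 and 9.4.3] -/
theorem typeRank_sigmaType_eq_iff_not_exists_multiplicities_of_pointwise [MulAction.IsPretransitive G (E i₀)]
    [MulAction.IsPretransitive G (E i₁)] (h : ∀ i, IsCMTypeWith ρ (Φ i)) (hI : ∀ j, j = i₀ ∨ j = i₁) (h01 : i₀ ≠ i₁)
    (hirr : ∀ W : Submodule ℚ (E i₀ → ℚ), W ≤ antiSpan G (Φ i₀) → W ≠ ⊥ →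
      (∀ (k : G) (f : E i₀ → ℚ), f ∈ W → (fun y => f (k • y)) ∈ W) → W = antiSpan G (Φ i₀))
    (hnd₀ : typeRank G (Φ i₀) = Fintype.card (E i₀) / 2 + 1)
    (r : E i₁ → E i₀) (hr : ∀ (g : G) (y : E i₁), r (g • y) = g • r y) {x₀ : E i₀}
    (hpc : ∀ y : E i₁, r y ≠ x₀ → r y ≠ ρ • x₀ → ∃ σ : G, σ • x₀ = ρ • x₀ ∧ σ • y = y) :
    typeRank G (sigmaType Φ) = Fintype.card (Σ i, E i) / 2 + 1 ↔
      typeRank G (Φ i₁) = Fintype.card (E i₁) / 2 + 1 ∧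
        ¬ ∃ a b : ℕ, a ≠ b ∧ ∀ x : E i₀,
          (Finset.univ.filter fun y : E i₁ => r y = x ∧ y ∈ Φ i₁).card = if x ∈ Φ i₀ then a else b := by
  rw [← parallel_iff_exists_multiplicities (h i₀) (h i₁) r hr]
  constructor
  · intro hnd
    refine ⟨typeRank_eq_of_typeRank_sigmaType_eq h hnd i₁, fun ⟨c, hc⟩ => ?_⟩
    have h1 := typeRank_sigmaType_add_card_eq_of_forall_map_le h
      (forall_map_slotExt_le_of_typeRank_sigmaType_eq h hnd)
    have h2 := typeRank_sigmaType_add_card_lt_of_parallel_self h h01 r hr hc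
    omega
  · rintro ⟨hnd₁, hnot⟩
    rw [typeRank_sigmaType_eq_iff_forall_of_forall_map_le h
      ((forall_map_le_iff_not_parallel_of_pointwise h hI h01 hirr r hr hpc).2 hnot)]
    intro i
    rcases hI i with rfl | rfl
    · exact hnd₀
    · exact hnd₁

/-- **Pair-flip base, pointwise partial conjugations**: if the base slot has pair flips (so `U(Φ_{i₀})` is irreducible and
`Φ_{i₀}` nondegenerate) and the off-fibre points of one `x₀` carry pointwise partial conjugations, then `Σ` is nondegenerate
IFF `Φ_{i₁}` is nondegenerate and not of constant unequal multiplicities over `Φ_{i₀}`. [cite: Dodson1984, §5.1.2]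
[cite: Gordon1999HodgeAVSurvey, 7.5–7.7 and 9.4.3] -/
theorem typeRank_sigmaType_eq_iff_of_pairFlip_of_pointwise [MulAction.IsPretransitive G (E i₀)]
    [MulAction.IsPretransitive G (E i₁)] (h : ∀ i, IsCMTypeWith ρ (Φ i)) (hI : ∀ j, j = i₀ ∨ j = i₁) (h01 : i₀ ≠ i₁)
    (hflip : ∀ x : E i₀, ∃ φ : G, φ • x = ρ • x ∧ ∀ x' : E i₀, x' ≠ x → x' ≠ ρ • x → φ • x' = x')
    (r : E i₁ → E i₀) (hr : ∀ (g : G) (y : E i₁), r (g • y) = g • r y) {x₀ : E i₀}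
    (hpc : ∀ y : E i₁, r y ≠ x₀ → r y ≠ ρ • x₀ → ∃ σ : G, σ • x₀ = ρ • x₀ ∧ σ • y = y) :
    typeRank G (sigmaType Φ) = Fintype.card (Σ i, E i) / 2 + 1 ↔
      typeRank G (Φ i₁) = Fintype.card (E i₁) / 2 + 1 ∧
        ¬ ∃ a b : ℕ, a ≠ b ∧ ∀ x : E i₀,
          (Finset.univ.filter fun y : E i₁ => r y = x ∧ y ∈ Φ i₁).card = if x ∈ Φ i₀ then a else b :=
  typeRank_sigmaType_eq_iff_not_exists_multiplicities_of_pointwise h hI h01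
    (antiSpan_irreducible_of_pairFlip (h i₀) hflip) (typeRank_eq_of_pairFlip (h i₀) hflip) r hr hpc

end Family

end Summit.HodgeConjecture.CorCM.Shadow

end
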